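import Summits.AtomisticToContinuum.Crystallization.Theorems.ChargedEnergyGapBarlowRef
import HarnessLib

/-!
# Charged energy gap — lens-3 g64, node «BarlowRef» (R3) — part 2 of 2: the rotation sub-family, the (R3) bulk residual and the chain,
# the witness (`9/10 ≤ a₀√2`, `fccRef a₀` is a Barlow image), the per-site pass-load `TubeLoad` (P-Z₅c (i)×(ii)) and the shadow lemmas

Sequel of `…Theorems.ChargedEnergyGapBarlowRef` (part 1: §R1 Barlow images are labelled, §R2 the pair (H𝄪ᴮ)/(N𝄪ᴮ), §R3 record cones), whose module
docstring describes the whole node; this file holds §R4–§R7.  Same namespace; 0 sorry; standard axioms.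
-/

noncomputable section

open scoped Classical
open Literature.MathematicalPhysics.StatisticalMechanics Literature.Geometry.DiscreteGeometry
open Summit.AtomisticToContinuum.Crystallization.Theses.PricedLinkCensus
open Summit.AtomisticToContinuum.Crystallization.Theorems.ChargedEnergyGapNegative

namespace Summit.AtomisticToContinuum.Crystallization.Theorems.ChargedEnergyGapChartDial


/-! ## §R4 ★★ The rotation sub-family of (H𝄪ᴮ), the (R3) bulk residual, and the chain -/

section RotationFamilyB

variable (s lam ℓ μ₀ τ lamQ ϱ b₀ r_S C_T ϱχ Cχ : ℝ)

/-- The **ROTATION SUB-FAMILY of (H𝄪ᴮ)**: its instances with `β₀ := W_{r₀,v}` a rotation cocycle and no seams (`k := 0`), every other binder and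
the conclusion verbatim (so (H𝄪ᴮ) ⟹ it by specialisation, `rotationFamilyB_of_localB`; `RotationFamilyS` ⟹ it, `rotationFamilyB_of_S`). -/
def RotationFamilyB : Prop :=
  ∃ C_H : ℝ, 0 ≤ C_H ∧ ∀ (P : PeriodicConfiguration 3) (C X : Set E3) (r₀ v : E3) (S : Fin 0 → CutPiece) (m : ℕ)
    (D : Fin m → Set E3) (σ : Fin m → Bool),
    IsSeparatedRef s P → IsLabelledRef lam ℓ P → IsBarlowImage P.points → IsForceFree P → IsSiteStressFree P → HarmStableModRot μ₀ P →
    IsInvariantSet P C → IsInvariantSet P X → IsGlobalCocycle P (rotField r₀ v) → IsSeamSystem b₀ r_S P S →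
    SmallStrain τ P X (volterraField P S (rotField r₀ v)) → (∀ i, IsInvariantSet P (D i)) →
    -(C_T * shellMassL ϱχ D σ P X ϱ C) - Cχ * transMassL ϱχ D σ P X ϱ C - C_H * (pricedNearCountL ϱχ D σ P X ϱ C : ℝ) ≤
      modelFarL ϱχ D σ (volterraField P S (rotField r₀ v)) P X lamQ ϱ C

/-- (H𝄪ᴮ) ⟹ its rotation sub-family (specialisation `β₀ := W_{r₀,v}`, `k := 0`). -/
theorem rotationFamilyB_of_localB (h : LocalSeamTransferBoundB s lam ℓ μ₀ τ lamQ ϱ b₀ r_S C_T ϱχ Cχ) :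
    RotationFamilyB s lam ℓ μ₀ τ lamQ ϱ b₀ r_S C_T ϱχ Cχ := by
  obtain ⟨C_H, hC, hall⟩ := h
  exact ⟨C_H, hC, fun P C X r₀ v S m D σ => hall P C X (rotField r₀ v) 0 S m D σ⟩

/-- `RotationFamilyS` ⟹ `RotationFamilyB` (one more hypothesis). -/
theorem rotationFamilyB_of_S (h : RotationFamilyS s lam ℓ μ₀ τ lamQ ϱ b₀ r_S C_T ϱχ Cχ) :
    RotationFamilyB s lam ℓ μ₀ τ lamQ ϱ b₀ r_S C_T ϱχ Cχ := by
  obtain ⟨C_H, hC, hall⟩ := h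
  exact ⟨C_H, hC, fun P C X r₀ v S m D σ h1 h2 _ h3 h4 h5 h6 h7 h8 h9 h10 h11 =>
    hall P C X r₀ v S m D σ h1 h2 h3 h4 h5 h6 h7 h8 h9 h10 h11⟩

/-- piece BULK-FAR-RESIDUEᴮ(`B_T`, `B_χ`, `B_H`) · UNDECIDED→TRUE-leaning at the record `(B_T, B_χ) = (1/2100, 1/46)`, `B_H` free · ATTACKABLE·M —
**THE (R3) BULK FAR-RESIDUE BOUND**: `bulkFarResidue ≤ B_T·shellMassL + B_χ·transMassL + B_H·pricedNearCountL` demanded only of the references of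
(H𝄪ᴮ): `s`-separated, `(lam, ℓ)`-labelled, BARLOW-IMAGE, force-free, site-stress-free, harmonically stable modulo rotations (`μ₀`), with
`Λ_P`-invariant centre set, excised set and localisation list.  THE 14231 RESIDUAL OF RECORD AFTER GENERATION 64 (at the record dials, §R4 end).
Why it might fail / content: segment charging through the boundary layer of the paying region (HANDOFF g63 §E/§I/§J; memo g64 §1–§2): the per-site
pass-load `TubeLoad` (§R6) of the bulk–far pairs routed through a carrier block, divided by the block's certified carrier count, must stay below
`B_T` (shell carriers), `B_χ·mass` (transition carriers) or `B_H` (priced-near carriers); under the Barlow binder the worst certified ratio is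
`≈ 0.1–0.3` (block radius `18–39`, isotropic kernel, density `≤ 2.16`), the funnel / tangency sub-case (d3) being the named risk. -/
def BulkFarResidueBoundB (s lam ℓ μ₀ ϱ ϱχ B_T B_χ B_H : ℝ) : Prop :=
  ∀ (P : PeriodicConfiguration 3) (C X : Set E3) (m : ℕ) (D : Fin m → Set E3) (σ : Fin m → Bool),
    IsSeparatedRef s P → IsLabelledRef lam ℓ P → IsBarlowImage P.points → IsForceFree P → IsSiteStressFree P → HarmStableModRot μ₀ P →
    IsInvariantSet P C → IsInvariantSet P X → (∀ i, IsInvariantSet P (D i)) →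
    bulkFarResidue ϱχ D σ P X ϱ C ≤
      B_T * shellMassL ϱχ D σ P X ϱ C + B_χ * transMassL ϱχ D σ P X ϱ C + B_H * (pricedNearCountL ϱχ D σ P X ϱ C : ℝ)

variable {s lam ℓ μ₀ τ lamQ ϱ b₀ r_S C_T ϱχ Cχ}

/-- The physical bulk bound (P-Z₅⁰) implies the (R3) one (the Barlow hypothesis is discarded); so does the geometric one (P-Z₃). -/
theorem bulkFarResidueBoundB_of_SF {B_T B_χ B_H : ℝ} (h : BulkFarResidueBoundSF s lam ℓ μ₀ ϱ ϱχ B_T B_χ B_H) :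
    BulkFarResidueBoundB s lam ℓ μ₀ ϱ ϱχ B_T B_χ B_H :=
  fun P C X m D σ hsep hlab _ hF hS hH hC hX hD => h P C X m D σ hsep hlab hF hS hH hC hX hD

/-- [formal bookkeeping] -/
theorem bulkFarResidueBoundB_of_bulk {B_T B_χ B_H : ℝ} (h : BulkFarResidueBound s lam ℓ ϱ ϱχ B_T B_χ B_H) :
    BulkFarResidueBoundB s lam ℓ μ₀ ϱ ϱχ B_T B_χ B_H :=
  bulkFarResidueBoundB_of_SF (bulkFarResidueBoundSF_of_bulk h)

/-- Larger constants give a weaker bound. [formal bookkeeping] -/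
theorem BulkFarResidueBoundB.mono {B_T B_χ B_H B_T' B_χ' B_H' : ℝ} (hT : B_T ≤ B_T') (hχ : B_χ ≤ B_χ') (hH : B_H ≤ B_H')
    (h : BulkFarResidueBoundB s lam ℓ μ₀ ϱ ϱχ B_T B_χ B_H) : BulkFarResidueBoundB s lam ℓ μ₀ ϱ ϱχ B_T' B_χ' B_H' := by
  intro P C X m D σ hsep hlab hb hF hS hH' hC hX hD
  have h1 := h P C X m D σ hsep hlab hb hF hS hH' hC hX hD
  have h2 := mul_le_mul_of_nonneg_right hT (shellMassL_nonneg ϱχ D σ P X ϱ C)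
  have h3 := mul_le_mul_of_nonneg_right hχ (transMassL_nonneg ϱχ D σ P X ϱ C)
  have h4 := mul_le_mul_of_nonneg_right hH (Nat.cast_nonneg (pricedNearCountL ϱχ D σ P X ϱ C) : (0 : ℝ) ≤ _)
  linarith

/-- ★★ **THE (R3) ROTATION SUB-FAMILY FROM THE (R3) BULK BOUND** — the chain P-X (`localS_conclusion_rotField_of_geomCharging`), P-Y
(`excisionMassL_le_near_add_far`), P-Z₃ (`farResidue_le_selfCharge`) pointwise in the instance (their hypotheses are separation, invariance and
site-stress-freeness only, so the instance's Barlow binder is simply handed to the residual): for `0 < s ≤ 1`, `s ≤ 3ϱ/8`, `1 ≤ 3ϱ/8`, a shell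
thickness `h > 0`, a tail constant `κ` at least P-Z₂'s, `λ, τ, B_H ≥ 0` and budgets `λτ²(B_T+κ) ≤ C_T`, `λτ²(B_χ+κ) ≤ Cχ`:
`BulkFarResidueBoundB s lam ℓ μ₀ ϱ ϱχ B_T B_χ B_H ⟹ RotationFamilyB s lam ℓ μ₀ τ λ ϱ b₀ r_S C_T ϱχ Cχ` (`C_H := λτ²(B_H + 1024/s³)`). -/
theorem rotationFamilyB_of_bulkB {B_T B_χ B_H : ℝ} (hs : 0 < s) (hs1 : s ≤ 1) (hϱ1 : 1 ≤ 3 * ϱ / 8) (hsϱ : s ≤ 3 * ϱ / 8)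
    {h : ℝ} (hh : 0 < h) (hlam : 0 ≤ lamQ) (hτ : 0 ≤ τ) (hBH : 0 ≤ B_H) (hB : BulkFarResidueBoundB s lam ℓ μ₀ ϱ ϱχ B_T B_χ B_H) (κ : ℝ)
    (hκ : (2 * h / s + 2) * (2 / s) ^ 2 * ((3 * ϱ / 8 + h + s / 2) / (3 * ϱ / 8)) ^ 2 * (3 / (3 * ϱ / 8) ^ 4 + 1 / (h * (3 * ϱ / 8) ^ 3)) ≤ κ)
    (hT : lamQ * τ ^ 2 * (B_T + κ) ≤ C_T) (hχ : lamQ * τ ^ 2 * (B_χ + κ) ≤ Cχ) :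
    RotationFamilyB s lam ℓ μ₀ τ lamQ ϱ b₀ r_S C_T ϱχ Cχ := by
  refine ⟨lamQ * τ ^ 2 * (B_H + 1024 / s ^ 3), by positivity, ?_⟩
  intro P C X r₀ v S m D σ hsep hlab hb hF hS hH' hC hX _ _ hW hD
  refine localS_conclusion_rotField_of_geomCharging ϱχ D σ X ϱ C hS hlam hτ S hW hX ?_
  have h1 := excisionMassL_le_near_add_far ϱχ σ ϱ hsep hs hs1 hX hC hD
  have h2 := farResidue_le_selfCharge ϱχ D σ X ϱ C hsep hs hϱ1 hsϱ hh
  have h3 := hB P C X m D σ hsep hlab hb hF hS hH' hC hX hD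
  have hsh := shellMassL_nonneg ϱχ D σ P X ϱ C
  have htr := transMassL_nonneg ϱχ D σ P X ϱ C
  have hpr : (0 : ℝ) ≤ (pricedNearCountL ϱχ D σ P X ϱ C : ℝ) := Nat.cast_nonneg _
  have hlt : 0 ≤ lamQ * τ ^ 2 := by positivity
  have hκM := mul_le_mul_of_nonneg_right hκ (add_nonneg hsh htr)
  have hE : excisionMassL ϱχ D σ P X ϱ C ≤ (B_T + κ) * shellMassL ϱχ D σ P X ϱ C + (B_χ + κ) * transMassL ϱχ D σ P X ϱ C +
      (B_H + 1024 / s ^ 3) * (pricedNearCountL ϱχ D σ P X ϱ C : ℝ) := by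
    nlinarith
  have h4 := mul_le_mul_of_nonneg_left hE hlt
  have h5 := mul_le_mul_of_nonneg_right hT hsh
  have h6 := mul_le_mul_of_nonneg_right hχ htr
  nlinarith

/-- ★ **NODE 64 — THE RECORD (R3) ROTATION SUB-FAMILY FROM THE (R3) BULK BOUND**: `BulkFarResidueBoundB (3/5) (1/3) 3 (1/100) 160 80 (1/2100)
(1/46) B_H` (any `B_H ≥ 0`) gives `RotationFamilyB (3/5) (1/3) 3 (1/100) (3/100) (1/2) 160 (2/5) 3 (1/3000000) 80 (1/100000)` (tail `κ = 1/3800`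
at `h = 12/5`, numerals `record_bulkSF_numerals`). -/
theorem rotationFamilyB_record_of_bulkBoundB {B_H : ℝ} (hBH : 0 ≤ B_H)
    (hB : BulkFarResidueBoundB (3 / 5) (1 / 3) 3 (1 / 100) 160 80 (1 / 2100) (1 / 46) B_H) :
    RotationFamilyB (3 / 5) (1 / 3) 3 (1 / 100) (3 / 100) (1 / 2) 160 (2 / 5) 3 (1 / 3000000) 80 (1 / 100000) :=
  rotationFamilyB_of_bulkB (by norm_num) (by norm_num) (by norm_num) (by norm_num) (h := 12 / 5) (by norm_num) (by norm_num) (by norm_num)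
    hBH hB (1 / 3800) (by norm_num) (by norm_num) (by norm_num)

/-- Consistency: the record physical bound (P-Z₅⁰) still closes the (R3) node. -/
theorem rotationFamilyB_record_of_bulkBoundSF {B_H : ℝ} (hBH : 0 ≤ B_H)
    (hB : BulkFarResidueBoundSF (3 / 5) (1 / 3) 3 (1 / 100) 160 80 (1 / 2100) (1 / 46) B_H) :
    RotationFamilyB (3 / 5) (1 / 3) 3 (1 / 100) (3 / 100) (1 / 2) 160 (2 / 5) 3 (1 / 3000000) 80 (1 / 100000) :=
  rotationFamilyB_record_of_bulkBoundB hBH (bulkFarResidueBoundB_of_SF hB)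

end RotationFamilyB

/-! ## §R5 ★★ The Lennard-Jones fcc equilibrium is a Barlow image: the (R3) hypothesis block is inhabited -/

namespace Fcc

/-- ★★ The certified LOWER window of the fcc equilibrium spacing: `9/10 ≤ a₀√2` — from `491/5000 ≤ a₀⁶ = Z(12)/Z(6)`
(`le_pow_six`, `a0_pow_six_ZZ`): `(a₀√2)⁶ = 8a₀⁶ ≥ 3928/5000 ≥ (9/10)⁶ = 531441/10⁶`.  (Numerically `a₀√2 ≈ 0.9712`; the tree had `3/5 ≤ a₀√2 ≤ 1`.) -/
theorem nine_tenths_le_a0_sqrt2 : 9 / 10 ≤ a0 * Real.sqrt 2 := by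
  have h6 : (9 / 10 : ℝ) ^ 6 ≤ (a0 * Real.sqrt 2) ^ 6 := by
    rw [mul_pow, show Real.sqrt 2 ^ 6 = (Real.sqrt 2 ^ 2) ^ 3 by ring, Real.sq_sqrt (by norm_num : (0 : ℝ) ≤ 2)]
    have := le_pow_six a0_pow_six_ZZ
    nlinarith
  have hpos : 0 ≤ a0 * Real.sqrt 2 := mul_nonneg a0_pos.le (Real.sqrt_nonneg _)
  exact le_of_pow_le_pow_left₀ (by norm_num) hpos h6

/-- The Barlow window of the fcc equilibrium spacing: `9/10 ≤ a₀√2 ≤ 11/10`. -/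
theorem a0_sqrt2_window : 9 / 10 ≤ a0 * Real.sqrt 2 ∧ a0 * Real.sqrt 2 ≤ 11 / 10 :=
  ⟨nine_tenths_le_a0_sqrt2, by linarith [a0_sqrt2_le_one]⟩

/-- The point set of `fccRef` depends on the scale only. [formal bookkeeping] -/
theorem fccRef_points_congr {b b' : ℝ} (hb : 0 < b) (hb' : 0 < b') (h : b = b') : (fccRef b hb).points = (fccRef b' hb').points := by
  subst h; rfl

/-- `bOf (a√2) = a`: cubic coordinate scale `a` has nearest-neighbour spacing `a√2`. [formal bookkeeping] -/
theorem bOf_self_mul_sqrt2 (a : ℝ) : bOf (a * Real.sqrt 2) = a := by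
  unfold bOf
  rw [mul_assoc, Real.mul_self_sqrt (by norm_num : (0 : ℝ) ≤ 2)]
  ring

/-- ★★ The Lennard-Jones fcc equilibrium `fccRef a₀` (the P-L witness of the record hypothesis block) IS A BARLOW IMAGE. -/
theorem isBarlowImage_fccRef_a0 : IsBarlowImage (fccRef a0 a0_pos).points := by
  have h := isBarlowImage_fcc a0_sqrt2_window
  rwa [fccRef_points_congr (bOf_pos (by linarith [nine_tenths_le_a0_sqrt2])) a0_pos (bOf_self_mul_sqrt2 a0)] at h

end Fcc

section WitnessB

/-- ★★ The admissibility block of (H𝄪ᴮ) at the record dials `(s, lam, ℓ, μ₀) = (3/5, 1/3, 3, 1/100)` —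
`IsSeparatedRef (3/5) ∧ IsLabelledRef (1/3) 3 ∧ IsBarlowImage ·.points ∧ IsForceFree ∧ IsSiteStressFree ∧ HarmStableModRot (1/100)` — is inhabited
(by `fccRef a₀`): the re-typed piece is NOT vacuous by an empty hypothesis block. -/
theorem hypothesisBlockB_record_inhabited : ∃ P : PeriodicConfiguration 3,
    IsSeparatedRef (3 / 5) P ∧ IsLabelledRef (1 / 3) 3 P ∧ IsBarlowImage P.points ∧ IsForceFree P ∧ IsSiteStressFree P ∧
      HarmStableModRot (1 / 100) P :=
  ⟨Fcc.fccRef Fcc.a0 Fcc.a0_pos, Fcc.fcc_witness.1, Fcc.fcc_witness.2.1, Fcc.isBarlowImage_fccRef_a0, Fcc.fcc_witness.2.2.1,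
    Fcc.isSiteStressFree_fcc, Fcc.harmStableModRot_fcc_a0_record⟩

/-- Under the Barlow binder the labelling binder at the record dials is automatic (§R1): the (R3) block is the (R2) block's force-free,
site-stress-free, stable, `3/5`-separated BARLOW IMAGES. -/
theorem isLabelledRef_record_of_isBarlowImage {P : PeriodicConfiguration 3} (hB : IsBarlowImage P.points) : IsLabelledRef (1 / 3) 3 P :=
  isLabelledRef_of_isBarlowImage hB 3 (by norm_num)

end WitnessB

/-! ## §R6 ★ The per-site pass-load (critic row 1191, P-Z₅c (i)×(ii)) -/

section TubeLoad

/-- **THE PASS-LOAD of a site `c` at tube radius `r`** from a finite source set `F` to a finite target set `G`: the kernel mass `Σ |y − z|⁻⁶` of the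
pairs `(y, z) ∈ F × G`, `y ≠ z`, whose segment `[y, z]` passes within `r` of `c`.  (Scheme-independent part of the per-carrier load of every
segment / chain charging scheme: a discrete chain with mesh `6/5` stays within `6/5` of its segment, so «`c` lies within `r_b` of a chain site of the
pair» implies «`[y, z]` passes within `r_b + 6/5` of `c`».) -/
def tubeLoad (r : ℝ) (c : E3) (F G : Finset E3) : ℝ :=
  ∑ y ∈ F, ∑ z ∈ G, if y ≠ z ∧ Metric.infDist c (segment ℝ y z) ≤ r then (dist y z)⁻¹ ^ 6 else 0

/-- piece TUBE-LOAD(`r`, `a₀`, `b₀`; `K`) · UNDECIDED (TRUE for `K` of the order `4π²r²ρ²/(6(a₀+b₀)²)`, `ρ ≤ 2.16`; memo g64 §1) · ATTACKABLE·S–M ·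
**THE PER-SITE PASS-LOAD BOUND over separated Barlow-image references**: for every `s`-separated reference whose point set is a Barlow image, every
site `c`, and all finite sets of reference points `F` (sources, at distance `≥ a₀` from `c`) and `G` (targets, at distance `≥ b₀` from `c`),
`tubeLoad r c F G ≤ K`.  Content: a source at distance `a` and a target at distance `b` have their segment within `r` of `c` only if the target
direction lies in the shadow cap of angular radius `≈ r(a+b)/(ab)` of the antipode of the source direction; shell counts of the Barlow image
(`24k²+2`-type cube layers or the tree's `card_shell_le`) then sum `Σ_a Σ_b #shell(a)·#cap(b)·(a+b)⁻⁶ ≲ 4π²r²ρ² ∫∫ (a+b)⁻⁴ = 4π²r²ρ²/(6(a₀+b₀)²)`.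
Why it might fail: only through the constant — the discretisation slop of shells and caps at small `a` (sources adjacent to the carrier block). -/
def TubeLoadBound (s r a₀ b₀ K : ℝ) : Prop :=
  ∀ (P : PeriodicConfiguration 3), IsSeparatedRef s P → IsBarlowImage P.points →
    ∀ (c : E3) (F G : Finset E3), (↑F : Set E3) ⊆ P.points → (↑G : Set E3) ⊆ P.points →
      (∀ y ∈ F, a₀ ≤ dist y c) → (∀ z ∈ G, b₀ ≤ dist z c) → tubeLoad r c F G ≤ K

/-- The pass-load is non-negative. -/
theorem tubeLoad_nonneg (r : ℝ) (c : E3) (F G : Finset E3) : 0 ≤ tubeLoad r c F G :=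
  Finset.sum_nonneg fun _ _ => Finset.sum_nonneg fun _ _ => by split_ifs <;> positivity

/-- The pass-load is monotone in the tube radius. -/
theorem tubeLoad_mono {r r' : ℝ} (h : r ≤ r') (c : E3) (F G : Finset E3) : tubeLoad r c F G ≤ tubeLoad r' c F G := by
  refine Finset.sum_le_sum fun y _ => Finset.sum_le_sum fun z _ => ?_
  by_cases h1 : y ≠ z ∧ Metric.infDist c (segment ℝ y z) ≤ r
  · rw [if_pos h1, if_pos ⟨h1.1, h1.2.trans h⟩]
  · rw [if_neg h1]
    split_ifs <;> positivity

/-- The pass-load is monotone in the source and target sets. -/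
theorem tubeLoad_mono_sets (r : ℝ) (c : E3) {F F' G G' : Finset E3} (hF : F ⊆ F') (hG : G ⊆ G') : tubeLoad r c F G ≤ tubeLoad r c F' G' := by
  unfold tubeLoad
  calc ∑ y ∈ F, ∑ z ∈ G, (if y ≠ z ∧ Metric.infDist c (segment ℝ y z) ≤ r then (dist y z)⁻¹ ^ 6 else (0 : ℝ))
      ≤ ∑ y ∈ F, ∑ z ∈ G', (if y ≠ z ∧ Metric.infDist c (segment ℝ y z) ≤ r then (dist y z)⁻¹ ^ 6 else (0 : ℝ)) :=
        Finset.sum_le_sum fun y _ => Finset.sum_le_sum_of_subset_of_nonneg hG fun z _ _ => by split_ifs <;> positivity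
    _ ≤ ∑ y ∈ F', ∑ z ∈ G', (if y ≠ z ∧ Metric.infDist c (segment ℝ y z) ≤ r then (dist y z)⁻¹ ^ 6 else (0 : ℝ)) :=
        Finset.sum_le_sum_of_subset_of_nonneg hF fun y _ _ => Finset.sum_nonneg fun z _ => by split_ifs <;> positivity

/-- A bound is monotone in the constant, antitone in the radius, and monotone in the exclusion radii. [formal bookkeeping] -/
theorem TubeLoadBound.mono {s r a₀ b₀ K r' a₀' b₀' K' : ℝ} (hr : r' ≤ r) (ha : a₀ ≤ a₀') (hb : b₀ ≤ b₀') (hK : K ≤ K')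
    (h : TubeLoadBound s r a₀ b₀ K) : TubeLoadBound s r' a₀' b₀' K' :=
  fun P hsep hB c F G hF hG hFa hGb =>
    ((tubeLoad_mono hr c F G).trans (h P hsep hB c F G hF hG (fun y hy => ha.trans (hFa y hy)) fun z hz => hb.trans (hGb z hz))).trans hK

end TubeLoad

/-! ## §R7 ★ The shadow lemmas (Euclidean half of P-Z₅c′) -/
section Shadow

/-- The tube condition of `tubeLoad` yields a point of the segment within `r` of `c` (segments are compact). -/
theorem exists_mem_segment_dist_le {c y z : E3} {r : ℝ} (h : Metric.infDist c (segment ℝ y z) ≤ r) :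
    ∃ p ∈ segment ℝ y z, dist p c ≤ r := by
  have hcpt : IsCompact (segment ℝ y z) := by
    rw [segment_eq_image']
    exact isCompact_Icc.image (continuous_const.add (continuous_id.smul continuous_const))
  obtain ⟨p, hp, hpe⟩ := hcpt.exists_infDist_eq_dist ⟨y, left_mem_segment ℝ y z⟩ c
  exact ⟨p, hp, by rwa [dist_comm, ← hpe]⟩

/-- ★ SHADOW TUBE (P-Z₅c′, first lemma).  If the segment `[y, z]` passes within `r` of `c` and the source `y`
is farther than `r` from `c` (`a := dist y c > r`, `b := dist z c`), then the target `z` lies within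
`r (a + b) / (a − r)` of a point `c + s • (c − y)` on the ray from `c` AWAY from `y`, with the ray parameter
pinned to `s ∈ [(b − r)/(a + r), (b + r)/(a − r)]`.  Pure Euclidean geometry (reverse triangle inequality on
`p − c = (1 − t)(y − c) + t(z − c)`); the counting half of the tube-load lemma sums ball counts over this shadow. -/
theorem tube_shadow {c y z p : E3} {r : ℝ} (hp : p ∈ segment ℝ y z) (hpc : dist p c ≤ r) (hry : r < dist y c) :
    ∃ s : ℝ, 0 ≤ s ∧ (dist z c - r) / (dist y c + r) ≤ s ∧ s ≤ (dist z c + r) / (dist y c - r) ∧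
      dist z (c + s • (c - y)) ≤ r * (dist y c + dist z c) / (dist y c - r) := by
  rw [segment_eq_image] at hp
  obtain ⟨t, ⟨ht0, ht1⟩, rfl⟩ := hp
  have hr : 0 ≤ r := dist_nonneg.trans hpc
  have ha : 0 < dist y c := lt_of_le_of_lt hr hry
  have hdec : (1 - t) • y + t • z - c = (1 - t) • (y - c) + t • (z - c) := by module
  have hpc' : ‖(1 - t) • (y - c) + t • (z - c)‖ ≤ r := by rwa [← hdec, ← dist_eq_norm]
  have hn1 : ‖(1 - t) • (y - c)‖ = (1 - t) * dist y c := by rw [norm_smul, Real.norm_of_nonneg (by linarith), dist_eq_norm]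
  have hn2 : ‖t • (z - c)‖ = t * dist z c := by rw [norm_smul, Real.norm_of_nonneg ht0, dist_eq_norm]
  have hkey1 : (1 - t) * dist y c - t * dist z c ≤ r := by
    have h3 := norm_add_le ((1 - t) • (y - c) + t • (z - c)) (-(t • (z - c)))
    rw [add_neg_cancel_right, norm_neg, hn1, hn2] at h3
    linarith
  have hkey2 : t * dist z c - (1 - t) * dist y c ≤ r := by
    have h3 := norm_add_le ((1 - t) • (y - c) + t • (z - c)) (-((1 - t) • (y - c)))
    rw [show (1 - t) • (y - c) + t • (z - c) + -((1 - t) • (y - c)) = t • (z - c) by abel, norm_neg, hn1, hn2] at h3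
    linarith
  have ht : 0 < t := by
    rcases eq_or_lt_of_le ht0 with h | h
    · subst h; simp at hkey1; linarith
    · exact h
  have hsub : 0 < dist y c - r := by linarith
  refine ⟨(1 - t) / t, div_nonneg (by linarith) ht.le, ?_, ?_, ?_⟩
  · rw [div_le_div_iff₀ (by linarith) ht]
    nlinarith
  · rw [div_le_div_iff₀ ht hsub]
    nlinarith
  · have hz : t • (z - (c + ((1 - t) / t) • (c - y))) = (1 - t) • y + t • z - c := by
      rw [smul_sub, smul_add, smul_smul, mul_div_cancel₀ _ ht.ne']
      module
    have hd : t * dist z (c + ((1 - t) / t) • (c - y)) ≤ r := by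
      have hcalc : t * dist z (c + ((1 - t) / t) • (c - y)) = dist ((1 - t) • y + t • z) c := by
        calc t * dist z (c + ((1 - t) / t) • (c - y))
            = ‖t‖ * ‖z - (c + ((1 - t) / t) • (c - y))‖ := by rw [Real.norm_of_nonneg ht.le, dist_eq_norm]
          _ = ‖t • (z - (c + ((1 - t) / t) • (c - y)))‖ := (norm_smul _ _).symm
          _ = dist ((1 - t) • y + t • z) c := by rw [hz, dist_eq_norm]
      rw [hcalc]; exact hpc
    rw [le_div_iff₀ hsub]
    have := mul_le_mul_of_nonneg_left hkey1 hr
    nlinarith [dist_nonneg (x := z) (y := c + ((1 - t) / t) • (c - y)), mul_le_mul_of_nonneg_left hkey1 (dist_nonneg (x := z) (y := c + ((1 - t) / t) • (c - y)))]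

/-- ★ SHADOW BALL.  All targets `z` at distance `b` from `c` whose segment from `y` (`dist y c = a > r`) passes
within `r` of `c` lie in ONE closed ball of radius `2 r (a + b)/(a − r)` around the antipodal point
`c + (b/a) • (c − y)` — the countable form (Barlow-image ball counts) of the shadow. -/
theorem tube_shadow_ball {c y z p : E3} {r : ℝ} (hp : p ∈ segment ℝ y z) (hpc : dist p c ≤ r) (hry : r < dist y c) :
    dist z (c + (dist z c / dist y c) • (c - y)) ≤ 2 * (r * (dist y c + dist z c) / (dist y c - r)) := by
  obtain ⟨s, hs0, -, -, hz⟩ := tube_shadow hp hpc hry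
  have hr : 0 ≤ r := dist_nonneg.trans hpc
  have ha : 0 < dist y c := lt_of_le_of_lt hr hry
  set a := dist y c with ha_def
  set b := dist z c with hb_def
  set w := c + s • (c - y) with hw
  have hwc : dist w c = s * a := by
    rw [hw, dist_eq_norm, add_sub_cancel_left, norm_smul, Real.norm_of_nonneg hs0, ← dist_eq_norm, dist_comm]
  have h1 : |s * a - b| ≤ dist z w := by
    rw [← hwc, hb_def, abs_sub_comm]
    have := abs_dist_sub_le z w c
    simpa [dist_comm] using this
  have hcy : ‖c - y‖ = a := by rw [← dist_eq_norm, dist_comm, ha_def]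
  have h2 : dist w (c + (b / a) • (c - y)) = |s * a - b| := by
    rw [hw, dist_eq_norm, add_sub_add_left_eq_sub, ← sub_smul, norm_smul, Real.norm_eq_abs, hcy,
      show s * a - b = (s - b / a) * a by field_simp, abs_mul, abs_of_pos ha]
  calc dist z (c + (b / a) • (c - y)) ≤ dist z w + dist w (c + (b / a) • (c - y)) := dist_triangle _ _ _
    _ ≤ r * (a + b) / (a - r) + |s * a - b| := by rw [h2]; linarith [hz]
    _ ≤ 2 * (r * (a + b) / (a - r)) := by linarith [h1.trans hz]

end Shadow

end Summit.AtomisticToContinuum.Crystallization.Theorems.ChargedEnergyGapChartDial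

end
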